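import Mathlib
import HarnessLib
import Summits.CriticalPhenomena.PercolationContinuityZ3.Theses.PercLowPointHalfSpace
import Summits.CriticalPhenomena.PercolationContinuityZ3.Theorems.PercLowPointHalfSpaceLowPointBookkeepingSharpDominatesLog

/-!
# The no-fat-half-box stub with exponent `m < 11/4` gives the route's crux B exactly

Continuation of `…LowPointBookkeepingSharpDominatesLog.lean` (line SketchIdeator1, skeleton
floor-russo, crux `LowPointBookkeeping`, stmt-CriticalPhenomena-14713): there B♯ at the registered
exponent `11/4` gives `TallClusterMassBound` up to a factor `1 + log r`
(`tallClusterMassBound_log_of_noFatHalfBox`).  Here: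

* `tail_of_noFat_exp` — the rooted exponential tail `P^{ℍ}_{p_c,1}(N_n ≥ t (C+1) n^m) ≤ e^{3/2} e^{-t/2}`
  from a no-fat-half-box hypothesis with a general exponent `m ≥ 0` for the origin half-box
  `B_n ∩ ℍ` (Hutchcroft's universal tightness, as in `DilutionToolkit.tail`);
* `tallClusterMassBound_of_noFatHalfBox_exp` — **B♯ with exponent `m < 11/4` ⇒ B** by name
  (`TallClusterMassBound`): the logarithm of the truncation lemma `mass_le_of_tail` is absorbed by
  `r^{11/4-m}`;
* `noFat_origin_of_noFatHalfBox` — the registered five-box B♯ contains the origin instance.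

Real world: `m = d_f ≈ 2.52 < 11/4`, so the hypothesis with some `m < 11/4` is as plausible as B♯.
-/

noncomputable section

open MeasureTheory Filter Topology
open Literature.Probability.Percolation Literature.Probability.LatticeModels
open scoped ENNReal Classical

namespace Summit.CriticalPhenomena.PercolationContinuityZ3.Theorems.FloorRusso.Dominates

open Summit.CriticalPhenomena.PercolationContinuityZ3.Theses.PercLowPointHalfSpace
open Summit.CriticalPhenomena.PercolationContinuityZ3.Theorems.QuantitativeBGN.Negative
  (armH armH_lower_bound)

/-- The critical bond percolation measure on `ℤ³` (local notation). -/
local notation3 (prettyPrint := false) "μc" =>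
  (bondPercolation (zdGraph 3) (criticalProbI 3) : Measure (BondConfig (Site 3)))

/-- The floor-diluted critical half-space measure at full floor density `s = 1` (local notation). -/
local notation3 (prettyPrint := false) "μ₁" =>
  (floorDilutedPercolation 3 (criticalProbI 3) 1 : Measure (BondConfig (Site 3)))

/-- The closed half-space `ℍ = {x₀ ≥ 0}` (local notation). -/
local notation3 (prettyPrint := false) "HS" => ({x : Site 3 | 0 ≤ x 0} : Set (Site 3))

/-- The mass of the half-space cluster of the origin in `B_r`: `N_r(ω) = #{y ∈ B_r | 0 ↔_ℍ y}`,
as a real number (local notation). -/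
local notation3 (prettyPrint := false) "𝑵⟦" r "," ω "⟧" =>
  ((((box 3 r).filter fun y : Site 3 => ω ∈ openConnIn HS (0 : Site 3) y).card : ℕ) : ℝ)

/-! ### B♯ with any exponent `m < 11/4` ⇒ B exactly -/

/-- **Rooted exponential tail from a no-fat-half-box hypothesis with exponent `m`** (the argument of
`DilutionToolkit.tail`, for the half-box `Λ_n = B_n ∩ ℍ` at the origin and a general exponent):
if `P^{ℍ}_{p_c,1}(|K_max(Λ_n)| ≥ C n^m) ≤ e^{-1}` for all `n ≥ 1`, then
`P^{ℍ}_{p_c,1}(N_n ≥ t (C+1) n^m) ≤ e^{3/2} e^{-t/2}` for all `n, t ≥ 1` — Hutchcroft's universal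
tightness (`prodBernoulli_real_clusterCapIn_ge_le_exp_mul`) at `α = t (C+1) n^m / M(Λ_n) ≥ t`,
since the typical value satisfies `M(Λ_n) ≤ ⌈C n^m⌉ ≤ (C+1) n^m`. -/
theorem tail_of_noFat_exp {m C : ℝ} (hm : 0 ≤ m) (hC : 0 < C)
    (hfat : ∀ n : ℕ, 1 ≤ n →
      (μ₁).real {ω | C * (n : ℝ) ^ m ≤
        (clusterMaxIn ((box 3 n).filter fun z : Site 3 => 0 ≤ z 0) ω : ℝ)} ≤ Real.exp (-1))
    (n : ℕ) (hn : 1 ≤ n) (t : ℝ) (ht : 1 ≤ t) :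
    (μ₁).real {ω | t * ((C + 1) * (n : ℝ) ^ m) ≤ 𝑵⟦n, ω⟧} ≤
      Real.exp (3 / 2) * Real.exp (-t / 2) := by
  obtain ⟨Λ, hΛdef⟩ : ∃ Λ : Finset (Site 3), Λ = (box 3 n).filter fun z : Site 3 => 0 ≤ z 0 :=
    ⟨_, rfl⟩
  have h0Λ : (0 : Site 3) ∈ Λ := by
    rw [hΛdef]
    exact Finset.mem_filter.2 ⟨zero_mem_box 3 n, le_rfl⟩
  have hΛ : Λ.Nonempty := ⟨0, h0Λ⟩
  obtain ⟨μ, hμdef⟩ : ∃ μ : Measure (BondConfig (Site 3)),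
      μ = prodBernoulli (floorDilutedParam 3 (criticalProbI 3) 1) := ⟨_, rfl⟩
  have hμ1 : floorDilutedPercolation 3 (criticalProbI 3) 1 = μ := hμdef.symm
  haveI : IsProbabilityMeasure μ := by rw [hμdef]; infer_instance
  obtain ⟨M, hMdef⟩ : ∃ M : ℕ, M = typicalMax μ Λ := ⟨_, rfl⟩
  obtain ⟨T, hTdef⟩ : ∃ T : ℝ, T = (C + 1) * (n : ℝ) ^ m := ⟨_, rfl⟩
  have hr1 : (1 : ℝ) ≤ (n : ℝ) ^ m := Real.one_le_rpow (by exact_mod_cast hn) hm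
  have hCr : 0 ≤ C * (n : ℝ) ^ m := mul_nonneg hC.le (by linarith)
  -- Step 1: `M ≤ T`
  have hMT : (M : ℝ) ≤ T := by
    have hk : μ.real {ω | ⌈C * (n : ℝ) ^ m⌉₊ ≤ clusterMaxIn Λ ω} ≤ Real.exp (-1) := by
      have h := hfat n hn
      rw [hμ1, ← hΛdef] at h
      refine le_trans (measureReal_mono (fun ω hω => ?_) (measure_ne_top _ _)) h
      simp only [Set.mem_setOf_eq] at hω ⊢
      exact le_trans (Nat.le_ceil _) (by exact_mod_cast hω)
    have hMk : M ≤ ⌈C * (n : ℝ) ^ m⌉₊ := hMdef ▸ Nat.sInf_le hk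
    have hMk' : (M : ℝ) ≤ ⌈C * (n : ℝ) ^ m⌉₊ := by exact_mod_cast hMk
    have hk2 := Nat.ceil_lt_add_one hCr
    rw [hTdef]
    nlinarith
  have hM2 : 2 ≤ M := hMdef ▸ two_le_typicalMax μ hΛ
  have hMpos : (0 : ℝ) < M := by exact_mod_cast lt_of_lt_of_le (by norm_num) hM2
  -- Step 2: universal tightness at level `α M = t T`
  obtain ⟨α, hαdef⟩ : ∃ α : ℝ, α = t * T / M := ⟨_, rfl⟩
  have hTM : 1 ≤ T / M := (one_le_div hMpos).2 hMT
  have ht0 : 0 ≤ t := le_trans zero_le_one ht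
  have htα : t ≤ α := by rw [hαdef, mul_div_assoc]; exact le_mul_of_one_le_right ht0 hTM
  have hα : 1 ≤ α := le_trans ht htα
  have hαM : α * M = t * T := by rw [hαdef]; exact div_mul_cancel₀ _ hMpos.ne'
  have key := prodBernoulli_real_clusterCapIn_ge_le_exp_mul
    (floorDilutedParam 3 (criticalProbI 3) 1) hΛ (0 : Site 3) hα
  rw [← hμdef, ← hMdef] at key
  -- Step 3: event inclusion `{t T ≤ N_n} ⊆ {α M ≤ |K_0 ∩ Λ|}`
  have h1 : (μ₁).real {ω | t * ((C + 1) * (n : ℝ) ^ m) ≤ 𝑵⟦n, ω⟧} ≤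
      μ.real {ω | α * M ≤ (clusterCapIn Λ ω 0 : ℝ)} := by
    rw [hμ1]
    refine measureReal_mono (fun ω hω => ?_) (measure_ne_top _ _)
    simp only [Set.mem_setOf_eq] at hω ⊢
    rw [hαM, hTdef, hΛdef]
    exact le_trans hω (by exact_mod_cast mass_le_clusterCapIn n ω)
  have h4 : μ.real {ω | α * M ≤ (clusterCapIn Λ ω 0 : ℝ)} ≤ Real.exp ((3 - α) / 2) := by
    refine le_trans key ?_
    refine le_trans (mul_le_mul_of_nonneg_left measureReal_le_one (Real.exp_pos _).le) ?_
    rw [mul_one]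
  have h5 : Real.exp ((3 - α) / 2) ≤ Real.exp (3 / 2) * Real.exp (-t / 2) := by
    rw [← Real.exp_add]
    exact Real.exp_le_exp.2 (by linarith)
  exact h1.trans (h4.trans h5)

/-- **B♯ with exponent `m < 11/4` ⇒ B.**  If for some `m < 11/4` the largest `ℍ`-cluster trace in the
half-box `B_n ∩ ℍ` is typically at most `C n^m` (`P^{ℍ}_{p_c,1}(|K_max| ≥ C n^m) ≤ e^{-1}`, `n ≥ 1`;
real world `m = d_f ≈ 2.52`), then the route's crux B `TallClusterMassBound` holds as typed: the
logarithm of `mass_le_of_tail` is absorbed by `r^{11/4 - m}` (`log r ≤ r^ε/ε`). -/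
theorem tallClusterMassBound_of_noFatHalfBox_exp {m : ℝ} (hm0 : 0 ≤ m) (hm : m < 11 / 4)
    (hB : ∃ C : ℝ, 0 < C ∧ ∀ n : ℕ, 1 ≤ n →
      (floorDilutedPercolation 3 (criticalProbI 3) 1).real {ω | C * (n : ℝ) ^ m ≤
        (clusterMaxIn ((box 3 n).filter fun z : Site 3 => 0 ≤ z 0) ω : ℝ)} ≤ Real.exp (-1)) :
    TallClusterMassBound := by
  obtain ⟨Cb, hCb, hfat⟩ := hB
  obtain ⟨ε, hεdef⟩ : ∃ ε : ℝ, ε = 11 / 4 - m := ⟨_, rfl⟩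
  have hε : 0 < ε := by rw [hεdef]; linarith
  refine ⟨(20 + 10 / ε) * (Cb + 1) + Real.exp (3 / 2), fun r hr => ?_⟩
  have htail : ∀ t : ℝ, 1 ≤ t →
      (μ₁).real {ω | t * ((Cb + 1) * (r : ℝ) ^ m) ≤ 𝑵⟦r, ω⟧} ≤
        Real.exp (3 / 2) * Real.exp (-t / 2) := tail_of_noFat_exp hm0 hCb hfat r hr
  have hM : 0 < (Cb + 1) * (r : ℝ) ^ m := by positivity
  have h := mass_le_of_tail hr hM htail
  change ∑ x ∈ box 3 r, (μc).real (openConnIn HS 0 x ∩ armH r) ≤ _ * (μc).real (armH r)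
  refine h.trans (mul_le_mul_of_nonneg_right ?_ measureReal_nonneg)
  have hr1 : (1 : ℝ) ≤ r := by exact_mod_cast hr
  have hr0 : (0 : ℝ) < r := by linarith
  have hlog := log_scale_le hr
  have hlr : 0 ≤ Real.log r := Real.log_nonneg hr1
  have hlε : Real.log r ≤ (r : ℝ) ^ ε / ε := Real.log_le_rpow_div hr0.le hε
  have hpow : (r : ℝ) ^ m * (r : ℝ) ^ ε = (r : ℝ) ^ ((11 : ℝ) / 4) := by
    rw [← Real.rpow_add hr0, hεdef]; norm_num
  have hmle : (r : ℝ) ^ m ≤ (r : ℝ) ^ ((11 : ℝ) / 4) := Real.rpow_le_rpow_of_exponent_le hr1 hm.le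
  have hRm : 0 ≤ (r : ℝ) ^ m := by positivity
  have hR : 1 ≤ (r : ℝ) ^ ((11 : ℝ) / 4) := Real.one_le_rpow hr1 (by norm_num)
  have hC1 : 0 ≤ Cb + 1 := by linarith
  have hE : 0 < Real.exp (3 / 2) := Real.exp_pos _
  -- `ℓ r^m ≤ r^{m+ε}/ε = r^{11/4}/ε`
  have hlm : Real.log r * (r : ℝ) ^ m ≤ (r : ℝ) ^ ((11 : ℝ) / 4) / ε := by
    calc Real.log r * (r : ℝ) ^ m ≤ (r : ℝ) ^ ε / ε * (r : ℝ) ^ m :=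
          mul_le_mul_of_nonneg_right hlε hRm
      _ = (r : ℝ) ^ ((11 : ℝ) / 4) / ε := by rw [← hpow]; ring
  calc 2 * Real.log (15876 * (r : ℝ) ^ 5) * ((Cb + 1) * (r : ℝ) ^ m) + Real.exp (3 / 2)
      ≤ 2 * (10 + 5 * Real.log r) * ((Cb + 1) * (r : ℝ) ^ m) + Real.exp (3 / 2) := by
        gcongr
    _ = (Cb + 1) * (20 * (r : ℝ) ^ m + 10 * (Real.log r * (r : ℝ) ^ m)) + Real.exp (3 / 2) := by
        ring
    _ ≤ (Cb + 1) * (20 * (r : ℝ) ^ ((11 : ℝ) / 4) + 10 * ((r : ℝ) ^ ((11 : ℝ) / 4) / ε)) +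
          Real.exp (3 / 2) * (r : ℝ) ^ ((11 : ℝ) / 4) := by
        refine add_le_add (mul_le_mul_of_nonneg_left (by linarith) hC1) ?_
        exact le_mul_of_one_le_right hE.le hR
    _ = ((20 + 10 / ε) * (Cb + 1) + Real.exp (3 / 2)) * (r : ℝ) ^ ((11 : ℝ) / 4) := by
        field_simp

/-- The registered B♯ (five half-boxes, exponent `11/4`) contains the origin half-box instance
used above (`x = 0`: `(0 + B_n) ∩ ℍ = B_n ∩ ℍ`). -/
theorem noFat_origin_of_noFatHalfBox
    (hB : ∃ C : ℝ, 0 < C ∧ ∀ x ∈ insert (0 : Site 3) ({Pi.single 1 1, Pi.single 1 (-1), Pi.single 2 1, Pi.single 2 (-1)} : Finset (Site 3)), ∀ n : ℕ, 1 ≤ n →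
      (floorDilutedPercolation 3 (criticalProbI 3) 1).real
        {ω | C * (n : ℝ) ^ ((11 : ℝ) / 4) ≤ (clusterMaxIn (((box 3 n).image fun y : Site 3 => x + y).filter fun z : Site 3 => 0 ≤ z 0) ω : ℝ)}
          ≤ Real.exp (-1)) :
    ∃ C : ℝ, 0 < C ∧ ∀ n : ℕ, 1 ≤ n →
      (floorDilutedPercolation 3 (criticalProbI 3) 1).real {ω | C * (n : ℝ) ^ ((11 : ℝ) / 4) ≤
        (clusterMaxIn ((box 3 n).filter fun z : Site 3 => 0 ≤ z 0) ω : ℝ)} ≤ Real.exp (-1) := by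
  obtain ⟨C, hC, h⟩ := hB
  refine ⟨C, hC, fun n hn => ?_⟩
  have h0 := h 0 (Finset.mem_insert_self _ _) n hn
  have himg : ((box 3 n).image fun y : Site 3 => (0 : Site 3) + y) = box 3 n := by
    simp only [zero_add, Finset.image_id']
  rw [himg] at h0
  exact h0

/-! ### Registered wrapper -/

/-- **Registered wrapper `stub_sharpDominatesB`**: for every exponent `0 ≤ m < 11/4`, the origin
no-fat-half-box hypothesis with exponent `m` gives the route's crux B `TallClusterMassBound` exactly;
verbatim `tallClusterMassBound_of_noFatHalfBox_exp`. -/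
theorem stub_sharpDominatesB : ∀ m : ℝ, 0 ≤ m → m < 11 / 4 → (∃ C : ℝ, 0 < C ∧ ∀ n : ℕ, 1 ≤ n → (floorDilutedPercolation 3 (criticalProbI 3) 1).real {ω | C * (n : ℝ) ^ m ≤ (clusterMaxIn ((box 3 n).filter fun z : Site 3 => 0 ≤ z 0) ω : ℝ)} ≤ Real.exp (-1)) → Summit.CriticalPhenomena.PercolationContinuityZ3.Theses.PercLowPointHalfSpace.TallClusterMassBound :=
  fun _ hm0 hm hB => tallClusterMassBound_of_noFatHalfBox_exp hm0 hm hB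

end Summit.CriticalPhenomena.PercolationContinuityZ3.Theorems.FloorRusso.Dominates

end
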